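import Mathlib
import Summits.Ventures.PercRepro2.CoinTreeCore
import Summits.Ventures.PercRepro2.CoinTreeAncestor
import Summits.Ventures.PercRepro2.CoinOrTailAlg
import Summits.Ventures.PercRepro2.CoinOrTailDefs
import Summits.Ventures.PercRepro2.CoinOrTailLsmDefs
import Summits.Ventures.PercRepro2.CoinOrTailLsmSums
import Summits.Ventures.PercRepro2.CoinOrTailBlockAlg
import Summits.Ventures.PercRepro2.CoinOrTailBlockSums
import Summits.Ventures.PercRepro2.CoinOrTailMixLsm
import Summits.Ventures.PercRepro2.CoinOrTailCovSums
import Summits.Ventures.PercRepro2.CoinOrTailCovCore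

/-!
# One marker above both entries, the other on a side branch — an instantiation check (blind
cell PercRepro2, night-2 g10; NIGHT2-DARC.md §40)

A concrete coin system on `Fin 8` (s = 0, m₁ = 1, r = 2, q = 3, a = 4, m₂ = 5, w = 6, t = 7):
the cut vertex `m₁` above both entries (`s → m₁ → r → a`, `m₁ → q → a`), a SIDE BRANCH
`s → m₂` that never reaches the tail, and the head coins `a → t`, `w → t`, `m₂ → t` — nine
coins, all random.  The core `U = {m₁, r, q, m₂}` is an out-tree (`TreeCore`, by `decide`),
`OrTailU` holds by `decide`, and `darc_of_orTailTreeCut` gives row 2′DARC at `a → w` for the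
markers `m₁, m₂` and every probability vector.  Neither §35–§39 theorem applies: `m₂` dominates
no entry (it is not on a route to the tail at all).
-/

namespace Summit.Ventures.PercRepro2.Coin

namespace OrTailCovExample

open Classical

/-- The nine coins of the example. -/
def arcsEx : Fin 9 → Finset (Fin 8 × Fin 8)
  | 0 => {(0, 1)}   -- s → m₁
  | 1 => {(1, 2)}   -- m₁ → r
  | 2 => {(1, 3)}   -- m₁ → q
  | 3 => {(2, 4)}   -- cρ : r → a
  | 4 => {(3, 4)}   -- cτ : q → a
  | 5 => {(0, 5)}   -- s → m₂ (side branch)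
  | 6 => {(4, 7)}   -- a → t
  | 7 => {(6, 7)}   -- w → t
  | 8 => {(5, 7)}   -- m₂ → t

/-- The tree coins. -/
def cEx : Fin 8 → Fin 9
  | 1 => 0
  | 2 => 1
  | 3 => 2
  | 5 => 5
  | _ => 0

/-- The parent map: `par m₁ = s`, `par r = m₁`, `par q = m₁`, `par m₂ = s`. -/
def parEx : Fin 8 → Fin 8
  | 1 => 0
  | 2 => 1
  | 3 => 1
  | 5 => 0
  | _ => 0

/-- The rank. -/
def rkEx : Fin 8 → ℕ
  | 1 => 1
  | 2 => 2
  | 3 => 2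
  | 5 => 1
  | _ => 0

/-- Every coin is a single arc, so `SameEnds` holds. -/
lemma sameEnds_ex : SameEnds arcsEx := by
  intro e xy hxy x'y' hx'y'
  fin_cases e <;> simp [arcsEx] at hxy hx'y' <;> subst hxy <;> subst hx'y' <;>
    exact ⟨Or.inl rfl, Or.inr rfl⟩

/-- `{m₁, r, q, m₂}` is an out-tree core of `s`. -/
lemma treeCore_ex : TreeCore arcsEx 0 {1, 2, 3, 5} cEx parEx rkEx where
  tree := by decide
  par_mem := by decide
  rank := by decide
  into_C := by decide
  into_s := by decide
  s_notin := by decide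

/-- The core with the tail `a = 4` entered from `r = 2` (coin `3`) and `q = 3` (coin `4`) is an
OR-tail. -/
lemma orTailU_ex : OrTailU arcsEx 0 {1, 2, 3, 5} 2 3 4 3 4 where
  p_mem := by decide
  q_mem := by decide
  s_notin := by decide
  a_notin := by decide
  a_ne_s := by decide
  into_U := by decide
  into_s := by decide
  into_a := by decide
  arcs_ρ := by decide
  arcs_τ := by decide
  ρτ_ne := by decide

/-- **Row 2′DARC at the arc `a → w` for the markers `m₁` (the cut vertex above both entries)
and `m₂` (a side branch) and every probability vector** — no hypothesis beyond `IsProbVec`. -/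
theorem darc_orTailCov_example {R : Type*} [Field R] [LinearOrder R] [IsStrictOrderedRing R]
    (pr : Fin 9 → R) (hp : IsProbVec pr) :
    DARC pr arcsEx 0 {7} 1 5 4 6 :=
  darc_of_orTailTreeCut pr hp sameEnds_ex orTailU_ex treeCore_ex (by decide) (by decide)
    (i := 1) (by decide) (by decide) (j := 1) (by decide) (by decide)
    (by decide) (by decide) (by decide) (by decide)

end OrTailCovExample

end Summit.Ventures.PercRepro2.Coin
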